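import Summits.AtomisticToContinuum.BoseEinsteinCondensation.Theorems.BECInsertionCorrectorStaticResponseBoundFewBodyComposition
import HarnessLib

/-!
# The few-body half of the static response bound, quintic window: the crux BY NAME is EQUIVALENT to its
# `N⁵ρa³ > c` content given the few-body layer (line `stable-fraction-square-completion`, seat a1 layer;
# item stmt-AtomisticToContinuum-12057 — this file supports, does not close, the item)

Registered stub `stub_composition5` of the seat-a1 skeleton: given the quintic few-body half `FewBodyBounded5`
(few-body regime `E₀·L² ≤ 4π²/5`, NO factor `N`, deficit `14t²N/|p|²`), the quintic window `FewBodyWindow5`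
(`N⁵·ρa³ ≤ c(v)` forces the few-body regime and the ultraviolet branch `ρa ≤ |p|²`) and the truncation limit
`TruncationLimit` (`E₀(min(v,n)) ↑ E₀(v)`), the crux `StaticResponseBound` is EQUIVALENT to `LargeNHalf5`, the crux
restricted to `N⁵ρa³ > c`.  Textual adaptation of
`Theorems/BECInsertionCorrectorStaticResponseBoundFewBodyComposition.lean` (exponent `8 ↦ 5`, constant `10 ↦ 14`,
few-body regime without the factor `N`).  Pure bookkeeping: `N = 0` by `ineq_N_zero`; for `N ≥ 1` split at
`N⁵ρa³ = c(v)`; below, the window + the truncation step `c5_fewBody_of_truncation` + the branch `max(ρa,|p|²) = |p|²`;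
above, `LargeNHalf5`; `ρ₀ = min`, `C = max(C_large, 14)`.
-/

noncomputable section

namespace Summit.AtomisticToContinuum.BoseEinsteinCondensation.Cruxes.StaticResponseBound.FewBody5

open MeasureTheory Filter
open scoped ENNReal NNReal BigOperators
open Literature.MathematicalPhysics.QuantumManyBody.BoseGas
open Summit.AtomisticToContinuum.BoseEinsteinCondensation.Theses
open Summit.AtomisticToContinuum.BoseEinsteinCondensation.Theses.BECInsertionCorrector
open Summit.AtomisticToContinuum.BoseEinsteinCondensation.Theorems.StaticResponseBound.Negative
open Summit.AtomisticToContinuum.BoseEinsteinCondensation.Cruxes.StaticResponseBound.UvThomsonForceWave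
open Summit.AtomisticToContinuum.BoseEinsteinCondensation.Cruxes.StaticResponseBound.FewBody

/-- **The quintic few-body half of the crux for every admissible `v`** from `FewBodyBounded5` (bounded profiles, first
hypothesis) and `TruncationLimit` (second hypothesis; hard cores: `E₀(min(v,n)) ↑ E₀(v)`) by monotonicity of the energy
in the profile: in the few-body regime `E₀(v,N,L)·L² ≤ 4π²/5` the crux's inequality holds with deficit `14t²N/|p|²`.
[folklore] -/
theorem c5_fewBody_of_truncation
    (hFB : ∀ w : ℝ → ℝ≥0∞, IsRepulsiveFiniteRange w → (∃ M : ℝ≥0∞, M ≠ ⊤ ∧ ∀ r, w r ≤ M) →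
        ∀ (N : ℕ) (L : ℝ), 0 < L →
          (periodicGroundStateEnergy w N L).toReal * L ^ 2 ≤ 4 * Real.pi ^ 2 / 5 →
          ∀ (k : Fin 3 → ℤ), k ≠ 0 → ∀ (t : ℝ) (Ψ : PeriodicTrialState N L), periodicEnergy w Ψ ≠ ⊤ →
            (periodicGroundStateEnergy w N L).toReal - 14 * t ^ 2 * N / psq L k
              ≤ (periodicEnergy w Ψ).toReal + t * cosMean L k Ψ)
    (hT : ∀ v : ℝ → ℝ≥0∞, IsRepulsiveFiniteRange v → ∀ (N : ℕ) (L : ℝ), 0 < L →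
        periodicGroundStateEnergy v N L ≠ ⊤ →
        ∀ ε : ℝ, 0 < ε → ∃ n₁ : ℕ, ∀ n : ℕ, n₁ ≤ n →
          (periodicGroundStateEnergy v N L).toReal ≤
            (periodicGroundStateEnergy (truncPotential v n) N L).toReal + ε)
    {v : ℝ → ℝ≥0∞} (hv : IsRepulsiveFiniteRange v) {N : ℕ} {L : ℝ} (hL : 0 < L)
    (hE : (periodicGroundStateEnergy v N L).toReal * L ^ 2 ≤ 4 * Real.pi ^ 2 / 5)
    {k : Fin 3 → ℤ} (hk : k ≠ 0) (t : ℝ) (Ψ : PeriodicTrialState N L) (hΨ : periodicEnergy v Ψ ≠ ⊤) :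
    (periodicGroundStateEnergy v N L).toReal - 14 * t ^ 2 * N / psq L k
      ≤ (periodicEnergy v Ψ).toReal + t * cosMean L k Ψ := by
  -- adapted from Theorems/BECInsertionCorrectorStaticResponseBoundFewBodyComposition.lean (`fewBody_of_truncation`)
  have hE0fin : periodicGroundStateEnergy v N L ≠ ⊤ :=
    ne_top_of_le_ne_top hΨ (periodicGroundStateEnergy_le v Ψ)
  -- the inequality for every truncation
  have key : ∀ n : ℕ, (periodicGroundStateEnergy (truncPotential v n) N L).toReal - 14 * t ^ 2 * N / psq L k
      ≤ (periodicEnergy v Ψ).toReal + t * cosMean L k Ψ := by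
    intro n
    obtain ⟨hwn, hbdd⟩ := truncPotential_admissible hv n
    have hΨn : periodicEnergy (truncPotential v n) Ψ ≠ ⊤ :=
      ne_top_of_le_ne_top hΨ (periodicEnergy_truncPotential_le' v n Ψ)
    have hEn_le : (periodicGroundStateEnergy (truncPotential v n) N L).toReal ≤
        (periodicGroundStateEnergy v N L).toReal :=
      ENNReal.toReal_mono hE0fin (periodicGroundStateEnergy_truncPotential_le' v n N L)
    have hEn : (periodicGroundStateEnergy (truncPotential v n) N L).toReal * L ^ 2 ≤
        4 * Real.pi ^ 2 / 5 :=
      le_trans (mul_le_mul_of_nonneg_right hEn_le (sq_nonneg L)) hE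
    have h := hFB (truncPotential v n) hwn hbdd N L hL hEn k hk t Ψ hΨn
    have hmono : (periodicEnergy (truncPotential v n) Ψ).toReal ≤ (periodicEnergy v Ψ).toReal :=
      ENNReal.toReal_mono hΨ (periodicEnergy_truncPotential_le' v n Ψ)
    linarith
  -- pass to the limit `n → ∞`
  refine le_of_forall_pos_le_add fun ε hε => ?_
  obtain ⟨n₁, hn₁⟩ := hT v hv N L hL hE0fin ε hε
  have h1 := hn₁ n₁ le_rfl
  have h2 := key n₁
  linarith

/-- **Composition (binder form): the crux `StaticResponseBound` BY NAME from the quintic few-body half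
(`FewBodyBounded5`), the quintic few-body window (`FewBodyWindow5`), the truncation limit (`TruncationLimit`) and the
many-body half (`LargeNHalf5`)** (texts inlined, in this order).  `N = 0` by `ineq_N_zero`; for `N ≥ 1` split at
`N⁵ρa³ = c(v)`: below, the window gives the few-body regime and the ultraviolet branch (`max(ρa,|p|²) = |p|²`) and
`c5_fewBody_of_truncation` the inequality with `C = 14`; above, `LargeNHalf5`; `ρ₀ = min`, `C = max`. [folklore] -/
theorem c5_staticResponseBound_of_fewBody'
    (hFB : ∀ w : ℝ → ℝ≥0∞, IsRepulsiveFiniteRange w → (∃ M : ℝ≥0∞, M ≠ ⊤ ∧ ∀ r, w r ≤ M) →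
        ∀ (N : ℕ) (L : ℝ), 0 < L →
          (periodicGroundStateEnergy w N L).toReal * L ^ 2 ≤ 4 * Real.pi ^ 2 / 5 →
          ∀ (k : Fin 3 → ℤ), k ≠ 0 → ∀ (t : ℝ) (Ψ : PeriodicTrialState N L), periodicEnergy w Ψ ≠ ⊤ →
            (periodicGroundStateEnergy w N L).toReal - 14 * t ^ 2 * N / psq L k
              ≤ (periodicEnergy w Ψ).toReal + t * cosMean L k Ψ)
    (hW : ∀ v : ℝ → ℝ≥0∞, IsRepulsiveFiniteRange v →
        ∃ ρ₀ : ℝ, 0 < ρ₀ ∧ ∃ c : ℝ, 0 < c ∧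
          ∀ ρ : ℝ, 0 < ρ → ρ < ρ₀ → ∀ N : ℕ, 1 ≤ N →
            (N : ℝ) ^ 5 * (ρ * (scatteringLength v).toReal ^ 3) ≤ c →
            (periodicGroundStateEnergy v N (sideLength ρ N)).toReal * sideLength ρ N ^ 2
                ≤ 4 * Real.pi ^ 2 / 5 ∧
            ∀ k : Fin 3 → ℤ, k ≠ 0 → ρ * (scatteringLength v).toReal ≤ psq (sideLength ρ N) k)
    (hT : ∀ v : ℝ → ℝ≥0∞, IsRepulsiveFiniteRange v → ∀ (N : ℕ) (L : ℝ), 0 < L →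
        periodicGroundStateEnergy v N L ≠ ⊤ →
        ∀ ε : ℝ, 0 < ε → ∃ n₁ : ℕ, ∀ n : ℕ, n₁ ≤ n →
          (periodicGroundStateEnergy v N L).toReal ≤
            (periodicGroundStateEnergy (truncPotential v n) N L).toReal + ε)
    (hG : ∀ v : ℝ → ℝ≥0∞, IsRepulsiveFiniteRange v → ∀ c : ℝ, 0 < c →
        ∃ ρ₀ : ℝ, 0 < ρ₀ ∧ ∃ C : ℝ, 0 < C ∧
          ∀ ρ : ℝ, 0 < ρ → ρ < ρ₀ → ∀ N : ℕ,
            c < (N : ℝ) ^ 5 * (ρ * (scatteringLength v).toReal ^ 3) →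
            ∀ k : Fin 3 → ℤ, k ≠ 0 → ∀ t : ℝ, ∀ Ψ : PeriodicTrialState N (sideLength ρ N),
              periodicEnergy v Ψ ≠ ⊤ → Ineq v C ρ N k t Ψ) :
    StaticResponseBound := by
  -- adapted from Theorems/BECInsertionCorrectorStaticResponseBoundFewBodyComposition.lean
  -- (`staticResponseBound_of_fewBody'`)
  intro v hv
  obtain ⟨ρ₁, hρ₁, c, hc, hwin⟩ := hW v hv
  obtain ⟨ρ₂, hρ₂, C₂, hC₂, hlarge⟩ := hG v hv c hc
  refine ⟨min ρ₁ ρ₂, lt_min hρ₁ hρ₂, max C₂ 14, lt_of_lt_of_le hC₂ (le_max_left _ _), ?_⟩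
  intro ρ hρ hρlt N k hk t Ψ hΨ
  change Ineq v (max C₂ 14) ρ N k t Ψ
  rcases Nat.eq_zero_or_pos N with hN | hN
  · subst hN
    exact ineq_N_zero v _ ρ k t Ψ hΨ
  · by_cases hsmall : (N : ℝ) ^ 5 * (ρ * (scatteringLength v).toReal ^ 3) ≤ c
    · -- few-body regime
      have hL : 0 < sideLength ρ N := sideLength_pos hρ hN
      obtain ⟨hE, hbr⟩ := hwin ρ hρ (lt_of_lt_of_le hρlt (min_le_left _ _)) N hN hsmall
      have hfew := c5_fewBody_of_truncation hFB hT hv hL hE hk t Ψ hΨ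
      have hbranch : max (ρ * (scatteringLength v).toReal) (psq (sideLength ρ N) k) = psq (sideLength ρ N) k :=
        max_eq_right (hbr k hk)
      refine ineq_mono_const (C := 14) ?_ (le_max_right _ _)
      unfold Ineq
      rw [hbranch]
      linarith
    · -- many-body regime
      push Not at hsmall
      exact ineq_mono_const (hlarge ρ hρ (lt_of_lt_of_le hρlt (min_le_right _ _)) N hsmall k hk t Ψ hΨ)
        (le_max_left _ _)

/-- **Calibration: the crux implies its quintic many-body half `LargeNHalf5`** (drop the hypothesis). [folklore] -/
theorem c5_largeNHalf5_of_staticResponseBound (h : StaticResponseBound) :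
    ∀ v : ℝ → ℝ≥0∞, IsRepulsiveFiniteRange v → ∀ c : ℝ, 0 < c →
      ∃ ρ₀ : ℝ, 0 < ρ₀ ∧ ∃ C : ℝ, 0 < C ∧
        ∀ ρ : ℝ, 0 < ρ → ρ < ρ₀ → ∀ N : ℕ,
          c < (N : ℝ) ^ 5 * (ρ * (scatteringLength v).toReal ^ 3) →
          ∀ k : Fin 3 → ℤ, k ≠ 0 → ∀ t : ℝ, ∀ Ψ : PeriodicTrialState N (sideLength ρ N),
            periodicEnergy v Ψ ≠ ⊤ → Ineq v C ρ N k t Ψ := by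
  -- adapted from Theorems/BECInsertionCorrectorStaticResponseBoundFewBodyComposition.lean
  -- (`largeNHalf_of_staticResponseBound`)
  intro v hv c _
  obtain ⟨ρ₀, hρ₀, C, hC, hbody⟩ := h v hv
  exact ⟨ρ₀, hρ₀, C, hC, fun ρ hρ hρlt N _ k hk t Ψ hΨ => hbody ρ hρ hρlt N k hk t Ψ hΨ⟩

/-- **Stub `stub_composition5` (bookkeeping).**  Given the quintic few-body half (`FewBodyBounded5`), the quintic window
(`FewBodyWindow5`) and the truncation limit (`TruncationLimit`), the crux `StaticResponseBound` is EQUIVALENT to its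
`N⁵ρa³ > c` content (`LargeNHalf5`). -/
theorem stub_composition5 :
    (∀ w : ℝ → ℝ≥0∞, IsRepulsiveFiniteRange w → (∃ M : ℝ≥0∞, M ≠ ⊤ ∧ ∀ r, w r ≤ M) →
      ∀ (N : ℕ) (L : ℝ), 0 < L →
        (periodicGroundStateEnergy w N L).toReal * L ^ 2 ≤ 4 * Real.pi ^ 2 / 5 →
        ∀ (k : Fin 3 → ℤ), k ≠ 0 → ∀ (t : ℝ) (Ψ : PeriodicTrialState N L), periodicEnergy w Ψ ≠ ⊤ →
          (periodicGroundStateEnergy w N L).toReal - 14 * t ^ 2 * N / psq L k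
            ≤ (periodicEnergy w Ψ).toReal + t * cosMean L k Ψ) →
    (∀ v : ℝ → ℝ≥0∞, IsRepulsiveFiniteRange v →
      ∃ ρ₀ : ℝ, 0 < ρ₀ ∧ ∃ c : ℝ, 0 < c ∧
        ∀ ρ : ℝ, 0 < ρ → ρ < ρ₀ → ∀ N : ℕ, 1 ≤ N →
          (N : ℝ) ^ 5 * (ρ * (scatteringLength v).toReal ^ 3) ≤ c →
          (periodicGroundStateEnergy v N (sideLength ρ N)).toReal * sideLength ρ N ^ 2
              ≤ 4 * Real.pi ^ 2 / 5 ∧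
          ∀ k : Fin 3 → ℤ, k ≠ 0 → ρ * (scatteringLength v).toReal ≤ psq (sideLength ρ N) k) →
    (∀ v : ℝ → ℝ≥0∞, IsRepulsiveFiniteRange v → ∀ (N : ℕ) (L : ℝ), 0 < L →
      periodicGroundStateEnergy v N L ≠ ⊤ →
      ∀ ε : ℝ, 0 < ε → ∃ n₁ : ℕ, ∀ n : ℕ, n₁ ≤ n →
        (periodicGroundStateEnergy v N L).toReal ≤
          (periodicGroundStateEnergy (truncPotential v n) N L).toReal + ε) →
    (StaticResponseBound ↔
      ∀ v : ℝ → ℝ≥0∞, IsRepulsiveFiniteRange v → ∀ c : ℝ, 0 < c →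
        ∃ ρ₀ : ℝ, 0 < ρ₀ ∧ ∃ C : ℝ, 0 < C ∧
          ∀ ρ : ℝ, 0 < ρ → ρ < ρ₀ → ∀ N : ℕ,
            c < (N : ℝ) ^ 5 * (ρ * (scatteringLength v).toReal ^ 3) →
            ∀ k : Fin 3 → ℤ, k ≠ 0 → ∀ t : ℝ, ∀ Ψ : PeriodicTrialState N (sideLength ρ N),
              periodicEnergy v Ψ ≠ ⊤ → Ineq v C ρ N k t Ψ) :=
  fun hFB hW hT => ⟨c5_largeNHalf5_of_staticResponseBound, c5_staticResponseBound_of_fewBody' hFB hW hT⟩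

end Summit.AtomisticToContinuum.BoseEinsteinCondensation.Cruxes.StaticResponseBound.FewBody5

end
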